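import Literature.NumberTheory.GaloisRepresentations.LubinTateColemanCoordMomentsBasisTwo
import Literature.NumberTheory.GaloisRepresentations.LubinTateColemanCoordCoinvariantsTwo
import HarnessLib

/-!
# The moment functionals FACTOR THROUGH THE `Δ`-COINVARIANTS (`q = 2`): `mom_k(r) = φ_ε(r)(γ^{k+1} − 1) · mom_k(1)` with `ε = (−1)^{k+1}`,
# `φ_ε : M → Λ` the `ε`-coinvariant coordinate (`M/(σ_{−1} − ε)M ≅ Λ`) — the weights of parity `ε` read the ideal `φ_ε(C) ⊆ Λ` of a submodule `C`

De Shalit, *Iwasawa theory of elliptic curves with complex multiplication* (1987), Ch. I §3.1, §3.5 (11); Ch. III §1.8 (14)–(15), §1.10 (17)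
(`char (𝒰/𝒞)_χ = (μ(𝔤; χ))`: the `χ`-part of the units modulo elliptic units is cyclic with generator read off the measure, whose values
at the characters `κ^k` are `L`-values — II §4.14 (36), III §1.11 (18)).  The tree has the two halves at `q = 2`:
`LubinTateColemanCoordCoinvariantsTwo` (`colemanDeltaCoinvFun ε = φ_ε : M →ₗ Λ`, `M ⧸ (σ_{−1} − ε)M ≃ₗ Λ`, `M ⧸ (N ⊔ (σ_{−1} − ε)M) ≃ₗ Λ ⧸ φ_ε(N)`;
with `…CoinvariantCharTwo`: `char (N/C)_ε = char Λ/φ_ε(C)`) and `LubinTateColemanCoordMomentsBasisTwo` (`mom_k(r) = (c₀(a_k) + (−1)^{k+1}c₁(a_k))·mom_k(1)`).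
THIS file joins them (everything PROVED, 0 sorry, no definitions):

* ★★ `coordMoment_eq_tEval_colemanDeltaCoinvFun` — **`mom_k(r) = φ_ε(r)(a_k) · mom_k(1)`**, `ε = (−1)^{k+1}`, `a_k = γ^{k+1} − 1`: the weight-`(k+1)`
  moment is the `(π)`-adic evaluation at `a_k` of the `ε`-COINVARIANT COORDINATE, times the universal constant;
* `coordMoment_unitTwistₗ_neg_one_sub` (**`mom_k` kills `(σ_{−1} − ε)M`**, no basis needed), `coordMoment_eq_zero_of_mem_range_sub`;
* for a `Λ`-submodule `C ≤ M` (e.g. `Col` of the closure of the elliptic units): ★ `coordMoment_eq_of_mem_of_map_le_span` — if `φ_ε(C) ⊆ (L)` then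
  **`mom_k(r) ∈ L(a_k)·mom_k(1)·𝒪_E` for every `r ∈ C`** (explicitly `= t(a_k)·L(a_k)·mom_k(1)`); ★ `exists_mem_coordMoment_eq_of_mem_map` — every
  `c ∈ φ_ε(C)` (in particular a generator) has `c(a_k)·mom_k(1) = mom_k(r)` for some `r ∈ C`: **the values at the weights of parity `ε` of the
  ideal `φ_ε(C)` — whose quotient `Λ/φ_ε(C)` computes `char (N/C)_ε` — are moments of elements of `C`** (for `C = Col 𝒞̄`: Coates–Wiles values of
  elliptic units, i.e. `L`-values, by `coordMoment_relUnitCoordTwo_eq_coatesWiles`).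

## References
* E. de Shalit, *Iwasawa theory of elliptic curves with complex multiplication* (1987), Ch. I §3.1, §3.5 (11); Ch. III §1.8 (14)–(15), §1.10 (17),
  §1.11 (18). [deShalit1987]
* K. Rubin, *The "main conjectures" of Iwasawa theory for imaginary quadratic fields*, Invent. Math. 103 (1991), §4. [Rubin1991]
-/

noncomputable section

open PowerSeries

namespace Literature.NumberTheory.GaloisRepresentations

section CoordMomentsCoinvariantTwo

open GaloisRepresentations.IsNonarchimedeanLocalField LubinTate ValuativeRel Field

variable {F : Type} [Field F] [ValuativeRel F] [TopologicalSpace F] [IsNonarchimedeanLocalField F]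

attribute [local instance] ltNormUniformSpace ltNormIsUniformAddGroup rk1 nF nE fintypeResidueField

variable {π : 𝒪[F]} (hπ : (valuation F).IsUniformizer (π : F))
variable (E : IntermediateField F (AlgebraicClosure F)) [FiniteDimensional F E]
variable (hq : residueFieldCard F = 2) (u : (LTCoeff F)ˣ) (hu : LTCoeff.of F π = residueFieldCard F * u) (γ : 𝒪[F]ˣ)
variable [IsAdicComplete (Ideal.span {algebraMap (LTCoeff F) (unitBall E) (LTCoeff.of F π)}) (unitBall E)]

/-- `(-1)^n` evaluates to `(-1)^n`. [folklore] -/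
private theorem tEval_neg_one_pow' {a : unitBall E} (ha : a ∈ Ideal.span {algebraMap (LTCoeff F) (unitBall E) (LTCoeff.of F π)}) (n : ℕ) :
    tEval ha ((-1 : PowerSeries (unitBall E)) ^ n) = (-1) ^ n := by
  rw [← tEvalHom_apply, map_pow, map_neg, map_one]

omit [IsAdicComplete (Ideal.span {algebraMap (LTCoeff F) (unitBall E) (LTCoeff.of F π)}) (unitBall E)] in
/-- `(−1 : 𝒪_F^×)` read in `𝒪_E` is `−1`. [folklore] -/
private theorem algebraMap_units_neg_one' : algebraMap 𝒪[F] (unitBall E) ((-1 : 𝒪[F]ˣ) : 𝒪[F]) = -1 := by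
  rw [Units.val_neg, Units.val_one, map_neg, map_one]

/-! ### §1. `mom_k` kills `(σ_{−1} − ε)M`, `ε = (−1)^{k+1}` -/

include hu in
/-- **`mom_k(σ_{−1} r − ε r) = 0`**, `ε = (−1)^{k+1}` (`mom_k(σ_{−1} r) = (−1)^{k+1} mom_k(r)`). [cite: deShalit1987, Ch. I §3.4 Lemma (ii), §3.5 (ii)] -/
theorem coordMoment_unitTwistₗ_neg_one_sub (k : ℕ) (r : ColemanCoordModule hπ hq (algebraMap (LTCoeff F) (unitBall E)) u hu γ) :
    coordMoment hπ E u k (TActModule.toPS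
      ((unitTwistₗ hπ hq (algebraMap (LTCoeff F) (unitBall E)) u hu γ (-1) - ((-1) ^ (k + 1) : PowerSeries (unitBall E)) •
        (LinearMap.id : ColemanCoordModule hπ hq (algebraMap (LTCoeff F) (unitBall E)) u hu γ →ₗ[PowerSeries (unitBall E)]
          ColemanCoordModule hπ hq (algebraMap (LTCoeff F) (unitBall E)) u hu γ)) r)) = 0 := by
  rw [LinearMap.sub_apply, LinearMap.smul_apply, LinearMap.id_apply, map_sub, ← coordMomentₗ_apply, map_sub, coordMomentₗ_apply,
    coordMomentₗ_apply, coordMoment_unitTwistₗ hπ E hq u hu γ, coordMoment_smul hπ E hq u hu γ, algebraMap_units_neg_one', tEval_neg_one_pow',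
    sub_self]

include hu in
/-- **`mom_k` vanishes on `range(σ_{−1} − ε)`**, `ε = (−1)^{k+1}`: it factors through the `ε`-coinvariants `M ⧸ (σ_{−1} − ε)M`.
[cite: deShalit1987, Ch. III §1.8 (14)] -/
theorem coordMoment_eq_zero_of_mem_range_sub (k : ℕ) (r : ColemanCoordModule hπ hq (algebraMap (LTCoeff F) (unitBall E)) u hu γ)
    (hr : r ∈ LinearMap.range (unitTwistₗ hπ hq (algebraMap (LTCoeff F) (unitBall E)) u hu γ (-1) -
      ((-1) ^ (k + 1) : PowerSeries (unitBall E)) •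
        (LinearMap.id : ColemanCoordModule hπ hq (algebraMap (LTCoeff F) (unitBall E)) u hu γ →ₗ[PowerSeries (unitBall E)]
          ColemanCoordModule hπ hq (algebraMap (LTCoeff F) (unitBall E)) u hu γ))) :
    coordMoment hπ E u k (TActModule.toPS r) = 0 := by
  obtain ⟨s, rfl⟩ := hr
  exact coordMoment_unitTwistₗ_neg_one_sub hπ E hq u hu γ k s

/-! ### §2. `mom_k = (φ_ε(·))(a_k) · mom_k(1)` -/

variable (hreg : ∀ x : unitBall E, algebraMap (LTCoeff F) (unitBall E) (LTCoeff.of F π) * x = 0 → x = 0)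
  (w : 𝒪[F]ˣ) (hγ : (γ : 𝒪[F]) = 1 + π ^ 2 * w)

include hu in
/-- ★★ **`mom_k(r) = φ_ε(r)(a_k) · mom_k(1)`**, `ε = (−1)^{k+1}`, `a_k = γ^{k+1} − 1`, `φ_ε = colemanDeltaCoinvFun ε` the `ε`-coinvariant
coordinate (`a·1 + c·σ_{−1}(1) ↦ a + εc`). [cite: deShalit1987, Ch. I §3.1, §3.5 (11); Ch. III §1.8 (14)] -/
theorem coordMoment_eq_tEval_colemanDeltaCoinvFun (k : ℕ) (r : ColemanCoordModule hπ hq (algebraMap (LTCoeff F) (unitBall E)) u hu γ) :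
    coordMoment hπ E u k (TActModule.toPS r) =
      tEval (algebraMap_unit_pow_sub_one_mem hπ E hq γ k)
          (colemanDeltaCoinvFun hπ hq (algebraMap (LTCoeff F) (unitBall E)) u hu γ hreg w hγ ((-1) ^ (k + 1)) r) *
        coordMoment hπ E u k 1 := by
  have hφ : colemanDeltaCoinvFun hπ hq (algebraMap (LTCoeff F) (unitBall E)) u hu γ hreg w hγ ((-1) ^ (k + 1)) r =
      (coordBasisDelta hπ hq (algebraMap (LTCoeff F) (unitBall E)) u hu γ hreg w hγ).repr r 0 +
        (-1) ^ (k + 1) * (coordBasisDelta hπ hq (algebraMap (LTCoeff F) (unitBall E)) u hu γ hreg w hγ).repr r 1 :=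
    deltaCoinvFun_apply _ _ _
  rw [hφ, coordMoment_eq_repr_coordBasisDelta hπ E hq u hu γ hreg w hγ, tEval_add, tEval_mul, tEval_neg_one_pow']

include hu in
/-- ★ **If `φ_ε(C) ⊆ (L)` then `mom_k(r) = t(a_k) · L(a_k) · mom_k(1)` for every `r ∈ C`** (`ε = (−1)^{k+1}`; `t` with `φ_ε(r) = t·L`): the
moments of parity `ε` of a submodule are multiples of the weight values of a generator of (an ideal containing) its `ε`-coinvariant image.
[cite: deShalit1987, Ch. III §1.8 (15), §1.10 (17)] -/
theorem coordMoment_eq_of_mem_of_map_le_span (k : ℕ) (C : Submodule (PowerSeries (unitBall E)) (ColemanCoordModule hπ hq (algebraMap (LTCoeff F) (unitBall E)) u hu γ))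
    (L : PowerSeries (unitBall E))
    (hC : C.map (colemanDeltaCoinvFun hπ hq (algebraMap (LTCoeff F) (unitBall E)) u hu γ hreg w hγ ((-1) ^ (k + 1))) ≤ Ideal.span {L})
    {r : ColemanCoordModule hπ hq (algebraMap (LTCoeff F) (unitBall E)) u hu γ} (hr : r ∈ C) :
    ∃ t : PowerSeries (unitBall E), coordMoment hπ E u k (TActModule.toPS r) =
      tEval (algebraMap_unit_pow_sub_one_mem hπ E hq γ k) t * tEval (algebraMap_unit_pow_sub_one_mem hπ E hq γ k) L * coordMoment hπ E u k 1 := by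
  obtain ⟨t, ht⟩ := Ideal.mem_span_singleton'.mp (hC (Submodule.mem_map_of_mem hr))
  refine ⟨t, ?_⟩
  rw [coordMoment_eq_tEval_colemanDeltaCoinvFun hπ E hq u hu γ hreg w hγ, ← ht, tEval_mul]

include hu in
/-- If `φ_ε(C) ⊆ (L)`, the moments of parity `ε` of `C` lie in the ideal `(L(a_k) · mom_k(1))` of `𝒪_E`. [cite: deShalit1987, Ch. III §1.8 (15), §1.10 (17)] -/
theorem coordMoment_mem_span_of_mem_of_map_le_span (k : ℕ) (C : Submodule (PowerSeries (unitBall E)) (ColemanCoordModule hπ hq (algebraMap (LTCoeff F) (unitBall E)) u hu γ))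
    (L : PowerSeries (unitBall E))
    (hC : C.map (colemanDeltaCoinvFun hπ hq (algebraMap (LTCoeff F) (unitBall E)) u hu γ hreg w hγ ((-1) ^ (k + 1))) ≤ Ideal.span {L})
    {r : ColemanCoordModule hπ hq (algebraMap (LTCoeff F) (unitBall E)) u hu γ} (hr : r ∈ C) :
    coordMoment hπ E u k (TActModule.toPS r) ∈ Ideal.span {tEval (algebraMap_unit_pow_sub_one_mem hπ E hq γ k) L * coordMoment hπ E u k 1} := by
  obtain ⟨t, ht⟩ := coordMoment_eq_of_mem_of_map_le_span hπ E hq u hu γ hreg w hγ k C L hC hr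
  rw [ht, mul_assoc]
  exact Ideal.mul_mem_left _ _ (Ideal.mem_span_singleton_self _)

include hu in
/-- ★ **Every element of the `ε`-coinvariant image `φ_ε(C)` — in particular a GENERATOR when `φ_ε(C)` is principal — has its weight-`(k+1)` value
realised as a moment: `c(a_k) · mom_k(1) = mom_k(r)` for some `r ∈ C`** (`ε = (−1)^{k+1}`).  For `C = Col(𝒞̄)` these moments are Coates–Wiles values of
elliptic units (`coordMoment_relUnitCoordTwo_eq_coatesWiles`), i.e. `L`-values. [cite: deShalit1987, Ch. III §1.10 (17), §1.11 (18)] -/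
theorem exists_mem_coordMoment_eq_of_mem_map (k : ℕ) (C : Submodule (PowerSeries (unitBall E)) (ColemanCoordModule hπ hq (algebraMap (LTCoeff F) (unitBall E)) u hu γ))
    {c : PowerSeries (unitBall E)}
    (hc : c ∈ C.map (colemanDeltaCoinvFun hπ hq (algebraMap (LTCoeff F) (unitBall E)) u hu γ hreg w hγ ((-1) ^ (k + 1)))) :
    ∃ r ∈ C, coordMoment hπ E u k (TActModule.toPS r) = tEval (algebraMap_unit_pow_sub_one_mem hπ E hq γ k) c * coordMoment hπ E u k 1 := by
  obtain ⟨r, hr, rfl⟩ := Submodule.mem_map.mp hc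
  exact ⟨r, hr, coordMoment_eq_tEval_colemanDeltaCoinvFun hπ E hq u hu γ hreg w hγ k r⟩

include hu in
/-- **Weight values of `φ_ε(C)` vs. moments of `C`, as sets**: `(tEval_{a_k} '' φ_ε(C)) · mom_k(1) = mom_k '' C` (`ε = (−1)^{k+1}`).
[cite: deShalit1987, Ch. III §1.10 (17)] -/
theorem image_coordMoment_eq (k : ℕ) (C : Submodule (PowerSeries (unitBall E)) (ColemanCoordModule hπ hq (algebraMap (LTCoeff F) (unitBall E)) u hu γ)) :
    (fun r : ColemanCoordModule hπ hq (algebraMap (LTCoeff F) (unitBall E)) u hu γ => coordMoment hπ E u k (TActModule.toPS r)) '' (C : Set _) =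
      (fun c : PowerSeries (unitBall E) => tEval (algebraMap_unit_pow_sub_one_mem hπ E hq γ k) c * coordMoment hπ E u k 1) ''
        (C.map (colemanDeltaCoinvFun hπ hq (algebraMap (LTCoeff F) (unitBall E)) u hu γ hreg w hγ ((-1) ^ (k + 1))) : Set _) := by
  ext x
  constructor
  · rintro ⟨r, hr, rfl⟩
    exact ⟨_, Submodule.mem_map_of_mem hr, (coordMoment_eq_tEval_colemanDeltaCoinvFun hπ E hq u hu γ hreg w hγ k r).symm⟩
  · rintro ⟨c, hc, rfl⟩
    obtain ⟨r, hr, h⟩ := exists_mem_coordMoment_eq_of_mem_map hπ E hq u hu γ hreg w hγ k C hc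
    exact ⟨r, hr, h⟩

end CoordMomentsCoinvariantTwo

end Literature.NumberTheory.GaloisRepresentations
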